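import Summits.QuantumFields.QCD.Theses.QuarksAsStableAction
import Literature.MathematicalPhysics.QuantumLattice.WilsonDiracAP
import Literature.MathematicalPhysics.QuantumLattice.GrassmannIntegralProofs

/-!
# Spin structure of the time-sliced Wilson fermion matrix
(helper for crux stmt-QuantumFields-9737 `QuarksAsStableAction.StableActionBridge`, line `Sketch` —
F3-core STEP β; stub `wilsonSlice_spin_structure`)

Time-slicing the `r = 1` Wilson–Dirac matrix at fixed time `t` (index `site × colour × spin` on the
spatial torus `(ℤ/L)³`) produces the slice operator `A_t`, the temporal hops `W_t = ρ(U(x,0)) ⊗ 1_spin`,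
`W′_t = ρ(U(x,0)⁻¹) ⊗ 1_spin` and the Wilson time projections `P± = ½ (1 ± γ₀)` (on spin only).  The
slice operator splits as `A_t = B_t ⊗ 1_spin + ½ Σ_j (H_j − H_j⁻) ⊗ γ_j` with the *spin-blind* operator
`B_t = (m + 4) − ½ Σ_j (H_j + H_j⁻)` (Lüscher's `B`, Smit's `A(U)`; `H_j`, `H_j⁻` the forward/backward
spatial gauge hops).  Since `γ_j` (`j = 1, 2, 3`) anticommutes with `γ₀`, the `γ_j`-part is killed
between two equal time projections, `P⁻ γ_j P⁻ = 0`, whence `P⁻ A_t P⁻ = (B_t ⊗ 1) P⁻`; `B_t ⊗ 1`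
commutes with `P±` and has determinant `(det B_t)⁴`; the temporal hops act on colour only, so they
commute with `P±`, and `W′_t W_t = 1` because `ρ(g⁻¹) ρ(g) = ρ(1) = 1` (no unitarity of `ρ` is used).
[cite: Luscher1977, pp. 283–292]; prose: Smit, *Introduction to Quantum Fields on a Lattice*, §6.5
(6.74)–(6.75).

Proof organisation.  Everything is converted to Kronecker products on `(site × colour) × spin`,
transported to `site × colour × spin` along `Equiv.prodAssoc` by the algebra equivalence
`Matrix.reindexAlgEquiv`; the nine claims are then `Matrix.mul_kronecker_mul` bookkeeping plus the two
`4 × 4` identities `P⁻ P⁻ = P⁻`, `P⁻ γ_j P⁻ = 0` (from the tree's Clifford relations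
`euclideanGamma_mul_self`, `euclideanGamma_mul_of_ne`).  Pure theorem file (no definitions).
-/

noncomputable section

namespace Summit.QuantumFields.QCD.Cruxes.StableActionBridge.Sketch

open Literature.MathematicalPhysics.QuantumLattice Literature.MathematicalPhysics.QuantumFieldTheory
open Literature.Probability.LatticeModels (TorusSite)

namespace SliceSpin

open Matrix
open scoped Kronecker

/-! ### The `4 × 4` spin algebra -/

/-- The Wilson time projection `P⁻ = ½ (1 - γ₀)` is idempotent (`γ₀² = 1`). -/
theorem projMinus_mul_self :
    (1 / 2 : ℂ) • (1 - euclideanGamma 0) * ((1 / 2 : ℂ) • (1 - euclideanGamma 0)) =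
      (1 / 2 : ℂ) • (1 - euclideanGamma 0) := by
  rw [Matrix.smul_mul, Matrix.mul_smul, smul_smul, sub_mul, one_mul, mul_sub, mul_one,
    euclideanGamma_mul_self]
  module

/-- `P⁻ γ_k P⁻ = 0` for the spatial gamma matrices `γ_k = euclideanGamma j.succ` (`k = 1, 2, 3`):
`γ₀ γ_k = -γ_k γ₀`, so `(1 - γ₀) γ_k (1 - γ₀) = γ_k (1 + γ₀) (1 - γ₀) = γ_k (1 - γ₀²) = 0`. -/
theorem projMinus_mul_gamma_mul_projMinus (j : Fin 3) :
    (1 / 2 : ℂ) • (1 - euclideanGamma 0) * euclideanGamma j.succ *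
        ((1 / 2 : ℂ) • (1 - euclideanGamma 0)) = 0 := by
  have h0 : euclideanGamma 0 * euclideanGamma j.succ =
      -(euclideanGamma j.succ * euclideanGamma 0) :=
    euclideanGamma_mul_of_ne (Fin.succ_ne_zero j).symm
  rw [Matrix.smul_mul, Matrix.smul_mul, Matrix.mul_smul, sub_mul, one_mul, h0, sub_neg_eq_add,
    add_mul, mul_sub, mul_sub, mul_one, mul_one, Matrix.mul_assoc (euclideanGamma j.succ),
    euclideanGamma_mul_self, mul_one, sub_add_sub_cancel, sub_self, smul_zero, smul_zero]

/-! ### Kronecker forms on `(site × colour) × spin`, transported along `Equiv.prodAssoc` -/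

variable {X Y : Type*} [Fintype X] [DecidableEq X] [Fintype Y] [DecidableEq Y]

/-- Entries of the transported Kronecker product `M ⊗ S` (`M` on `site × colour`, `S` on spin). -/
theorem reindex_kronecker_apply (M : Matrix (X × Y) (X × Y) ℂ) (S : Matrix (Fin 4) (Fin 4) ℂ)
    (a b : X × Y × Fin 4) :
    Matrix.reindexAlgEquiv ℂ ℂ (Equiv.prodAssoc X Y (Fin 4)) (M ⊗ₖ S) a b =
      M (a.1, a.2.1) (b.1, b.2.1) * S a.2.2 b.2.2 := rfl

/-- The spin lift `a b ↦ [a.site = b.site ∧ a.colour = b.colour] S a.spin b.spin` is `1 ⊗ S`. -/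
theorem of_spin_eq (S : Matrix (Fin 4) (Fin 4) ℂ) :
    (Matrix.of fun a b : X × Y × Fin 4 =>
        if a.1 = b.1 ∧ a.2.1 = b.2.1 then S a.2.2 b.2.2 else 0) =
      Matrix.reindexAlgEquiv ℂ ℂ (Equiv.prodAssoc X Y (Fin 4))
        ((1 : Matrix (X × Y) (X × Y) ℂ) ⊗ₖ S) := by
  ext ⟨x, n, α⟩ ⟨y, n', β⟩
  rw [reindex_kronecker_apply, Matrix.of_apply, Matrix.one_apply]
  by_cases hx : x = y <;> by_cases hn : n = n' <;> simp [hx, hn]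

/-- The spin-diagonal lift `a b ↦ [a.spin = b.spin] B (a.site, a.colour) (b.site, b.colour)` is
`B ⊗ 1`. -/
theorem of_spinDiag_eq (B : Matrix (X × Y) (X × Y) ℂ) :
    (Matrix.of fun a b : X × Y × Fin 4 =>
        if a.2.2 = b.2.2 then B (a.1, a.2.1) (b.1, b.2.1) else 0) =
      Matrix.reindexAlgEquiv ℂ ℂ (Equiv.prodAssoc X Y (Fin 4))
        (B ⊗ₖ (1 : Matrix (Fin 4) (Fin 4) ℂ)) := by
  ext ⟨x, n, α⟩ ⟨y, n', β⟩
  rw [reindex_kronecker_apply, Matrix.of_apply, Matrix.one_apply]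
  by_cases hα : α = β <;> simp [hα]

/-- A site-diagonal colour matrix `u x` lifted trivially to spin (the temporal hops) is `w ⊗ 1`
with `w` the site-block-diagonal matrix of the `u x` on `site × colour`. -/
theorem of_colour_eq (u : X → Matrix Y Y ℂ) :
    (Matrix.of fun a b : X × Y × Fin 4 =>
        if a.1 = b.1 ∧ a.2.2 = b.2.2 then u a.1 a.2.1 b.2.1 else 0) =
      Matrix.reindexAlgEquiv ℂ ℂ (Equiv.prodAssoc X Y (Fin 4))
        ((Matrix.of fun p q : X × Y => if p.1 = q.1 then u p.1 p.2 q.2 else 0) ⊗ₖ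
          (1 : Matrix (Fin 4) (Fin 4) ℂ)) := by
  ext ⟨x, n, α⟩ ⟨y, n', β⟩
  rw [reindex_kronecker_apply, Matrix.of_apply, Matrix.of_apply, Matrix.one_apply]
  by_cases hx : x = y <;> by_cases hα : α = β <;> simp [hx, hα]

/-- Site-block-diagonal colour matrices multiply blockwise: if `u' x * u x = 1` for every site then
the product of the two block-diagonal matrices is `1`. -/
theorem of_colour_mul_of_colour_eq_one (u' u : X → Matrix Y Y ℂ) (h : ∀ x, u' x * u x = 1) :
    (Matrix.of fun p q : X × Y => if p.1 = q.1 then u' p.1 p.2 q.2 else 0) *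
        (Matrix.of fun p q : X × Y => if p.1 = q.1 then u p.1 p.2 q.2 else 0) = 1 := by
  ext ⟨x, n⟩ ⟨y, n'⟩
  rw [Matrix.mul_apply, Fintype.sum_prod_type,
    Finset.sum_eq_single_of_mem x (Finset.mem_univ x) fun z _ hz => by simp [Ne.symm hz]]
  by_cases hxy : x = y
  · subst hxy
    simp only [Matrix.of_apply, if_true]
    rw [← Matrix.mul_apply, h]
    simp [Matrix.one_apply]
  · simp [hxy]

/-- **The decomposition `A_t = B_t ⊗ 1 + ½ Σ_j (H_j − H_j⁻) ⊗ γ_j`.**  The slice operator with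
diagonal `c`, forward hops `r j x` (condition `b.site = sh a.site j`, spin factor `1 - γ j`) and
backward hops `r' j y` (condition `a.site = sh b.site j`, spin factor `1 + γ j`) equals the spin-blind
part `B ⊗ 1`, `B = c - ½ Σ_j (h_j + h'_j)`, plus `Σ_j (½ (h_j - h'_j)) ⊗ γ j`. -/
theorem sliceOp_eq (c : ℂ) (sh : X → Fin 3 → X) (r r' : Fin 3 → X → Matrix Y Y ℂ)
    (γ : Fin 3 → Matrix (Fin 4) (Fin 4) ℂ) :
    (Matrix.of fun a b : X × Y × Fin 4 =>
        (if a = b then c else 0) -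
          (1 / 2 : ℂ) * ∑ j : Fin 3,
            ((if b.1 = sh a.1 j then
                ((1 : Matrix (Fin 4) (Fin 4) ℂ) - γ j) a.2.2 b.2.2 * r j a.1 a.2.1 b.2.1 else 0) +
              (if a.1 = sh b.1 j then
                ((1 : Matrix (Fin 4) (Fin 4) ℂ) + γ j) a.2.2 b.2.2 * r' j b.1 a.2.1 b.2.1 else 0))) =
      Matrix.reindexAlgEquiv ℂ ℂ (Equiv.prodAssoc X Y (Fin 4))
        ((Matrix.of fun p q : X × Y =>
            (if p = q then c else 0) -
              (1 / 2 : ℂ) * ∑ j : Fin 3,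
                ((if q.1 = sh p.1 j then r j p.1 p.2 q.2 else 0) +
                  (if p.1 = sh q.1 j then r' j q.1 p.2 q.2 else 0))) ⊗ₖ
            (1 : Matrix (Fin 4) (Fin 4) ℂ) +
          ∑ j : Fin 3,
            (Matrix.of fun p q : X × Y =>
              (1 / 2 : ℂ) * ((if q.1 = sh p.1 j then r j p.1 p.2 q.2 else 0) -
                (if p.1 = sh q.1 j then r' j q.1 p.2 q.2 else 0))) ⊗ₖ γ j) := by
  have key : ∀ (P Q : Prop) [Decidable P] [Decidable Q] (u v d g : ℂ),
      (if P then (d - g) * u else 0) + (if Q then (d + g) * v else 0) =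
        ((if P then u else 0) + (if Q then v else 0)) * d -
          2 * ((1 / 2 : ℂ) * ((if P then u else 0) - (if Q then v else 0)) * g) := by
    intros
    split_ifs <;> ring
  ext ⟨x, n, α⟩ ⟨y, n', β⟩
  rw [map_add, map_sum, Matrix.add_apply, Matrix.sum_apply]
  simp only [reindex_kronecker_apply, Matrix.of_apply, Matrix.sub_apply, Matrix.add_apply, key]
  rw [Finset.sum_sub_distrib, ← Finset.sum_mul, ← Finset.mul_sum]
  have hδ : (if (x, n, α) = (y, n', β) then c else 0) =
      (if (x, n) = (y, n') then c else 0) * (1 : Matrix (Fin 4) (Fin 4) ℂ) α β := by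
    rw [Matrix.one_apply]
    by_cases h1 : (x, n) = (y, n') <;> by_cases h2 : α = β <;> simp_all
  rw [hδ]
  ring

/-- **Kronecker form of the nine claims.**  For `Pp = 1 ⊗ P⁺`, `Pm = 1 ⊗ P⁻`,
`A = B ⊗ 1 + Σ_j C_j ⊗ γ_{j+1}`, `Bh = B ⊗ 1`, `W = w ⊗ 1`, `W' = w' ⊗ 1` with `w' w = 1`
(all transported along `Equiv.prodAssoc`): `Pm A Pm = Bh Pm`, `Bh` and `W`, `W'` commute with
`Pp`, `Pm`, `det Bh = (det B)⁴`, and `W' W = 1`. -/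
theorem kronecker_claims (B w w' : Matrix (X × Y) (X × Y) ℂ) (C : Fin 3 → Matrix (X × Y) (X × Y) ℂ)
    (hw : w' * w = 1) :
    Matrix.reindexAlgEquiv ℂ ℂ (Equiv.prodAssoc X Y (Fin 4))
            ((1 : Matrix (X × Y) (X × Y) ℂ) ⊗ₖ ((1 / 2 : ℂ) • (1 - euclideanGamma 0))) *
          Matrix.reindexAlgEquiv ℂ ℂ (Equiv.prodAssoc X Y (Fin 4))
            (B ⊗ₖ (1 : Matrix (Fin 4) (Fin 4) ℂ) + ∑ j : Fin 3, C j ⊗ₖ euclideanGamma j.succ) *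
          Matrix.reindexAlgEquiv ℂ ℂ (Equiv.prodAssoc X Y (Fin 4))
            ((1 : Matrix (X × Y) (X × Y) ℂ) ⊗ₖ ((1 / 2 : ℂ) • (1 - euclideanGamma 0))) =
        Matrix.reindexAlgEquiv ℂ ℂ (Equiv.prodAssoc X Y (Fin 4))
            (B ⊗ₖ (1 : Matrix (Fin 4) (Fin 4) ℂ)) *
          Matrix.reindexAlgEquiv ℂ ℂ (Equiv.prodAssoc X Y (Fin 4))
            ((1 : Matrix (X × Y) (X × Y) ℂ) ⊗ₖ ((1 / 2 : ℂ) • (1 - euclideanGamma 0))) ∧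
      Matrix.reindexAlgEquiv ℂ ℂ (Equiv.prodAssoc X Y (Fin 4))
            (B ⊗ₖ (1 : Matrix (Fin 4) (Fin 4) ℂ)) *
          Matrix.reindexAlgEquiv ℂ ℂ (Equiv.prodAssoc X Y (Fin 4))
            ((1 : Matrix (X × Y) (X × Y) ℂ) ⊗ₖ ((1 / 2 : ℂ) • (1 - euclideanGamma 0))) =
        Matrix.reindexAlgEquiv ℂ ℂ (Equiv.prodAssoc X Y (Fin 4))
            ((1 : Matrix (X × Y) (X × Y) ℂ) ⊗ₖ ((1 / 2 : ℂ) • (1 - euclideanGamma 0))) *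
          Matrix.reindexAlgEquiv ℂ ℂ (Equiv.prodAssoc X Y (Fin 4))
            (B ⊗ₖ (1 : Matrix (Fin 4) (Fin 4) ℂ)) ∧
      Matrix.reindexAlgEquiv ℂ ℂ (Equiv.prodAssoc X Y (Fin 4))
            (B ⊗ₖ (1 : Matrix (Fin 4) (Fin 4) ℂ)) *
          Matrix.reindexAlgEquiv ℂ ℂ (Equiv.prodAssoc X Y (Fin 4))
            ((1 : Matrix (X × Y) (X × Y) ℂ) ⊗ₖ ((1 / 2 : ℂ) • (1 + euclideanGamma 0))) =
        Matrix.reindexAlgEquiv ℂ ℂ (Equiv.prodAssoc X Y (Fin 4))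
            ((1 : Matrix (X × Y) (X × Y) ℂ) ⊗ₖ ((1 / 2 : ℂ) • (1 + euclideanGamma 0))) *
          Matrix.reindexAlgEquiv ℂ ℂ (Equiv.prodAssoc X Y (Fin 4))
            (B ⊗ₖ (1 : Matrix (Fin 4) (Fin 4) ℂ)) ∧
      (Matrix.reindexAlgEquiv ℂ ℂ (Equiv.prodAssoc X Y (Fin 4))
            (B ⊗ₖ (1 : Matrix (Fin 4) (Fin 4) ℂ))).det = B.det ^ 4 ∧
      Matrix.reindexAlgEquiv ℂ ℂ (Equiv.prodAssoc X Y (Fin 4))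
            (w ⊗ₖ (1 : Matrix (Fin 4) (Fin 4) ℂ)) *
          Matrix.reindexAlgEquiv ℂ ℂ (Equiv.prodAssoc X Y (Fin 4))
            ((1 : Matrix (X × Y) (X × Y) ℂ) ⊗ₖ ((1 / 2 : ℂ) • (1 + euclideanGamma 0))) =
        Matrix.reindexAlgEquiv ℂ ℂ (Equiv.prodAssoc X Y (Fin 4))
            ((1 : Matrix (X × Y) (X × Y) ℂ) ⊗ₖ ((1 / 2 : ℂ) • (1 + euclideanGamma 0))) *
          Matrix.reindexAlgEquiv ℂ ℂ (Equiv.prodAssoc X Y (Fin 4))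
            (w ⊗ₖ (1 : Matrix (Fin 4) (Fin 4) ℂ)) ∧
      Matrix.reindexAlgEquiv ℂ ℂ (Equiv.prodAssoc X Y (Fin 4))
            (w ⊗ₖ (1 : Matrix (Fin 4) (Fin 4) ℂ)) *
          Matrix.reindexAlgEquiv ℂ ℂ (Equiv.prodAssoc X Y (Fin 4))
            ((1 : Matrix (X × Y) (X × Y) ℂ) ⊗ₖ ((1 / 2 : ℂ) • (1 - euclideanGamma 0))) =
        Matrix.reindexAlgEquiv ℂ ℂ (Equiv.prodAssoc X Y (Fin 4))
            ((1 : Matrix (X × Y) (X × Y) ℂ) ⊗ₖ ((1 / 2 : ℂ) • (1 - euclideanGamma 0))) *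
          Matrix.reindexAlgEquiv ℂ ℂ (Equiv.prodAssoc X Y (Fin 4))
            (w ⊗ₖ (1 : Matrix (Fin 4) (Fin 4) ℂ)) ∧
      Matrix.reindexAlgEquiv ℂ ℂ (Equiv.prodAssoc X Y (Fin 4))
            (w' ⊗ₖ (1 : Matrix (Fin 4) (Fin 4) ℂ)) *
          Matrix.reindexAlgEquiv ℂ ℂ (Equiv.prodAssoc X Y (Fin 4))
            ((1 : Matrix (X × Y) (X × Y) ℂ) ⊗ₖ ((1 / 2 : ℂ) • (1 + euclideanGamma 0))) =
        Matrix.reindexAlgEquiv ℂ ℂ (Equiv.prodAssoc X Y (Fin 4))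
            ((1 : Matrix (X × Y) (X × Y) ℂ) ⊗ₖ ((1 / 2 : ℂ) • (1 + euclideanGamma 0))) *
          Matrix.reindexAlgEquiv ℂ ℂ (Equiv.prodAssoc X Y (Fin 4))
            (w' ⊗ₖ (1 : Matrix (Fin 4) (Fin 4) ℂ)) ∧
      Matrix.reindexAlgEquiv ℂ ℂ (Equiv.prodAssoc X Y (Fin 4))
            (w' ⊗ₖ (1 : Matrix (Fin 4) (Fin 4) ℂ)) *
          Matrix.reindexAlgEquiv ℂ ℂ (Equiv.prodAssoc X Y (Fin 4))
            ((1 : Matrix (X × Y) (X × Y) ℂ) ⊗ₖ ((1 / 2 : ℂ) • (1 - euclideanGamma 0))) =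
        Matrix.reindexAlgEquiv ℂ ℂ (Equiv.prodAssoc X Y (Fin 4))
            ((1 : Matrix (X × Y) (X × Y) ℂ) ⊗ₖ ((1 / 2 : ℂ) • (1 - euclideanGamma 0))) *
          Matrix.reindexAlgEquiv ℂ ℂ (Equiv.prodAssoc X Y (Fin 4))
            (w' ⊗ₖ (1 : Matrix (Fin 4) (Fin 4) ℂ)) ∧
      Matrix.reindexAlgEquiv ℂ ℂ (Equiv.prodAssoc X Y (Fin 4))
            (w' ⊗ₖ (1 : Matrix (Fin 4) (Fin 4) ℂ)) *
          Matrix.reindexAlgEquiv ℂ ℂ (Equiv.prodAssoc X Y (Fin 4))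
            (w ⊗ₖ (1 : Matrix (Fin 4) (Fin 4) ℂ)) = 1 := by
  have comm : ∀ (M : Matrix (X × Y) (X × Y) ℂ) (S : Matrix (Fin 4) (Fin 4) ℂ),
      Matrix.reindexAlgEquiv ℂ ℂ (Equiv.prodAssoc X Y (Fin 4)) (M ⊗ₖ (1 : Matrix (Fin 4) (Fin 4) ℂ)) *
          Matrix.reindexAlgEquiv ℂ ℂ (Equiv.prodAssoc X Y (Fin 4))
            ((1 : Matrix (X × Y) (X × Y) ℂ) ⊗ₖ S) =
        Matrix.reindexAlgEquiv ℂ ℂ (Equiv.prodAssoc X Y (Fin 4))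
            ((1 : Matrix (X × Y) (X × Y) ℂ) ⊗ₖ S) *
          Matrix.reindexAlgEquiv ℂ ℂ (Equiv.prodAssoc X Y (Fin 4))
            (M ⊗ₖ (1 : Matrix (Fin 4) (Fin 4) ℂ)) := by
    intro M S
    rw [← map_mul, ← map_mul, ← Matrix.mul_kronecker_mul, ← Matrix.mul_kronecker_mul,
      Matrix.one_mul, Matrix.mul_one, Matrix.one_mul, Matrix.mul_one]
  refine ⟨?_, comm _ _, comm _ _, ?_, comm _ _, comm _ _, comm _ _, comm _ _, ?_⟩
  · -- `Pm A Pm = Bh Pm`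
    rw [← map_mul, ← map_mul, ← map_mul]
    congr 1
    rw [mul_add, add_mul, Finset.mul_sum, Finset.sum_mul]
    simp only [← Matrix.mul_kronecker_mul, Matrix.one_mul, Matrix.mul_one, projMinus_mul_self,
      projMinus_mul_gamma_mul_projMinus, Matrix.kronecker_zero, Finset.sum_const_zero, add_zero]
  · -- `det Bh = (det B)⁴`
    rw [Matrix.det_reindexAlgEquiv, Matrix.det_kronecker, Matrix.det_one, one_pow, mul_one,
      Fintype.card_fin]
  · -- `W' W = 1`
    rw [← map_mul, ← Matrix.mul_kronecker_mul, hw, Matrix.mul_one, Matrix.one_kronecker_one, map_one]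

end SliceSpin

open scoped Kronecker in
/-- **Spin structure of the Wilson slice operator** (stub `wilsonSlice_spin_structure` of line
`Sketch`, F3-core STEP β).  At fixed time `t`, with `P± = ½ (1 ± γ₀)` lifted to
`site × colour × spin`, the temporal hops `W = ρ(U(x,0)) ⊗ 1`, `W′ = ρ(U(x,0)⁻¹) ⊗ 1`, the `r = 1`
Wilson slice operator `A` and its spin-blind part `B` (`Bh = B ⊗ 1_spin`):
`P⁻ A P⁻ = Bh P⁻`, `Bh` commutes with `P±`, `det Bh = (det B)⁴`, `W`, `W′` commute with `P±`, and
`W′ W = 1`. [cite: Luscher1977, pp. 283–292] -/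
theorem wilsonSlice_spin_structure :
    ∀ (Nc L : ℕ) [NeZero L] (G : Type) [Group G] (ρ : G →* Matrix (Fin Nc) (Fin Nc) ℂ)
      (U : GaugeConfig 4 L G) (m : ℝ) (t : ZMod L),
      let Pp : Matrix (TorusSite 3 L × Fin Nc × Fin 4) (TorusSite 3 L × Fin Nc × Fin 4) ℂ := Matrix.of fun a b =>
        if a.1 = b.1 ∧ a.2.1 = b.2.1 then ((1 / 2 : ℂ) • (1 + euclideanGamma 0)) a.2.2 b.2.2 else 0;
      let Pm : Matrix (TorusSite 3 L × Fin Nc × Fin 4) (TorusSite 3 L × Fin Nc × Fin 4) ℂ := Matrix.of fun a b =>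
        if a.1 = b.1 ∧ a.2.1 = b.2.1 then ((1 / 2 : ℂ) • (1 - euclideanGamma 0)) a.2.2 b.2.2 else 0;
      let W : Matrix (TorusSite 3 L × Fin Nc × Fin 4) (TorusSite 3 L × Fin Nc × Fin 4) ℂ :=
        Matrix.of fun a b => if a.1 = b.1 ∧ a.2.2 = b.2.2 then
          ρ (U ((Fin.cons t a.1 : TorusSite 4 L), 0)) a.2.1 b.2.1 else 0;
      let W' : Matrix (TorusSite 3 L × Fin Nc × Fin 4) (TorusSite 3 L × Fin Nc × Fin 4) ℂ :=
        Matrix.of fun a b => if a.1 = b.1 ∧ a.2.2 = b.2.2 then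
          ρ (U ((Fin.cons t a.1 : TorusSite 4 L), 0))⁻¹ a.2.1 b.2.1 else 0;
      let A : Matrix (TorusSite 3 L × Fin Nc × Fin 4) (TorusSite 3 L × Fin Nc × Fin 4) ℂ :=
        Matrix.of fun a b =>
          (if a = b then ((m + 4 * 1 : ℝ) : ℂ) else 0) -
            (1 / 2 : ℂ) * ∑ j : Fin 3,
              ((if b.1 = Literature.MathematicalPhysics.QuantumFieldTheory.Site.shift a.1 j then
                  (((1 : ℝ) : ℂ) • (1 : Matrix (Fin 4) (Fin 4) ℂ) - euclideanGamma j.succ) a.2.2 b.2.2 *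
                    ρ (U ((Fin.cons t a.1 : TorusSite 4 L), j.succ)) a.2.1 b.2.1 else 0) +
                (if a.1 = Literature.MathematicalPhysics.QuantumFieldTheory.Site.shift b.1 j then
                  (((1 : ℝ) : ℂ) • (1 : Matrix (Fin 4) (Fin 4) ℂ) + euclideanGamma j.succ) a.2.2 b.2.2 *
                    ρ (U ((Fin.cons t b.1 : TorusSite 4 L), j.succ))⁻¹ a.2.1 b.2.1 else 0));
      let B : Matrix (TorusSite 3 L × Fin Nc) (TorusSite 3 L × Fin Nc) ℂ := Matrix.of fun a b =>
          (if a = b then ((m + 4 : ℝ) : ℂ) else 0) -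
            (1 / 2 : ℂ) * ∑ j : Fin 3,
              ((if b.1 = Literature.MathematicalPhysics.QuantumFieldTheory.Site.shift a.1 j then
                  ρ (U ((Fin.cons t a.1 : TorusSite 4 L), j.succ)) a.2 b.2 else 0) +
                (if a.1 = Literature.MathematicalPhysics.QuantumFieldTheory.Site.shift b.1 j then
                  ρ (U ((Fin.cons t b.1 : TorusSite 4 L), j.succ))⁻¹ a.2 b.2 else 0));
      let Bh : Matrix (TorusSite 3 L × Fin Nc × Fin 4) (TorusSite 3 L × Fin Nc × Fin 4) ℂ := Matrix.of fun a b =>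
          if a.2.2 = b.2.2 then B (a.1, a.2.1) (b.1, b.2.1) else 0;
      Pm * A * Pm = Bh * Pm ∧ Bh * Pm = Pm * Bh ∧ Bh * Pp = Pp * Bh ∧ Bh.det = B.det ^ 4 ∧
        W * Pp = Pp * W ∧ W * Pm = Pm * W ∧ W' * Pp = Pp * W' ∧ W' * Pm = Pm * W' ∧ W' * W = 1 := by
  intro Nc L _ G _ ρ U m t Pp Pm W W' A B Bh
  -- Kronecker forms of the seven matrices (index `(site × colour) × spin`, transported along
  -- `Equiv.prodAssoc`).
  have hPp : Pp = Matrix.reindexAlgEquiv ℂ ℂ (Equiv.prodAssoc (TorusSite 3 L) (Fin Nc) (Fin 4))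
      ((1 : Matrix (TorusSite 3 L × Fin Nc) (TorusSite 3 L × Fin Nc) ℂ) ⊗ₖ
        ((1 / 2 : ℂ) • (1 + euclideanGamma 0))) :=
    SliceSpin.of_spin_eq ((1 / 2 : ℂ) • (1 + euclideanGamma 0))
  have hPm : Pm = Matrix.reindexAlgEquiv ℂ ℂ (Equiv.prodAssoc (TorusSite 3 L) (Fin Nc) (Fin 4))
      ((1 : Matrix (TorusSite 3 L × Fin Nc) (TorusSite 3 L × Fin Nc) ℂ) ⊗ₖ
        ((1 / 2 : ℂ) • (1 - euclideanGamma 0))) :=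
    SliceSpin.of_spin_eq ((1 / 2 : ℂ) • (1 - euclideanGamma 0))
  have hW : W = Matrix.reindexAlgEquiv ℂ ℂ (Equiv.prodAssoc (TorusSite 3 L) (Fin Nc) (Fin 4))
      ((Matrix.of fun p q : TorusSite 3 L × Fin Nc =>
          if p.1 = q.1 then ρ (U ((Fin.cons t p.1 : TorusSite 4 L), 0)) p.2 q.2 else 0) ⊗ₖ
        (1 : Matrix (Fin 4) (Fin 4) ℂ)) :=
    SliceSpin.of_colour_eq fun x => ρ (U ((Fin.cons t x : TorusSite 4 L), 0))
  have hW' : W' = Matrix.reindexAlgEquiv ℂ ℂ (Equiv.prodAssoc (TorusSite 3 L) (Fin Nc) (Fin 4))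
      ((Matrix.of fun p q : TorusSite 3 L × Fin Nc =>
          if p.1 = q.1 then ρ (U ((Fin.cons t p.1 : TorusSite 4 L), 0))⁻¹ p.2 q.2 else 0) ⊗ₖ
        (1 : Matrix (Fin 4) (Fin 4) ℂ)) :=
    SliceSpin.of_colour_eq fun x => ρ (U ((Fin.cons t x : TorusSite 4 L), 0))⁻¹
  have hBh : Bh = Matrix.reindexAlgEquiv ℂ ℂ (Equiv.prodAssoc (TorusSite 3 L) (Fin Nc) (Fin 4))
      (B ⊗ₖ (1 : Matrix (Fin 4) (Fin 4) ℂ)) :=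
    SliceSpin.of_spinDiag_eq B
  have hA : A = Matrix.reindexAlgEquiv ℂ ℂ (Equiv.prodAssoc (TorusSite 3 L) (Fin Nc) (Fin 4))
      (B ⊗ₖ (1 : Matrix (Fin 4) (Fin 4) ℂ) +
        ∑ j : Fin 3,
          (Matrix.of fun p q : TorusSite 3 L × Fin Nc =>
            (1 / 2 : ℂ) *
              ((if q.1 = Literature.MathematicalPhysics.QuantumFieldTheory.Site.shift p.1 j then
                  ρ (U ((Fin.cons t p.1 : TorusSite 4 L), j.succ)) p.2 q.2 else 0) -
                (if p.1 = Literature.MathematicalPhysics.QuantumFieldTheory.Site.shift q.1 j then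
                  ρ (U ((Fin.cons t q.1 : TorusSite 4 L), j.succ))⁻¹ p.2 q.2 else 0))) ⊗ₖ
            euclideanGamma j.succ) := by
    simp only [A, B, mul_one, Complex.ofReal_one, one_smul]
    exact SliceSpin.sliceOp_eq ((m + 4 : ℝ) : ℂ)
      (fun x j => Literature.MathematicalPhysics.QuantumFieldTheory.Site.shift x j)
      (fun j x => ρ (U ((Fin.cons t x : TorusSite 4 L), j.succ)))
      (fun j y => ρ (U ((Fin.cons t y : TorusSite 4 L), j.succ))⁻¹) (fun j => euclideanGamma j.succ)
  have hρ : ∀ x : TorusSite 3 L,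
      ρ (U ((Fin.cons t x : TorusSite 4 L), 0))⁻¹ * ρ (U ((Fin.cons t x : TorusSite 4 L), 0)) = 1 :=
    fun x => by rw [← map_mul, inv_mul_cancel, map_one]
  rw [hPp, hPm, hW, hW', hA, hBh]
  exact SliceSpin.kronecker_claims B _ _ _
    (SliceSpin.of_colour_mul_of_colour_eq_one
      (fun x => ρ (U ((Fin.cons t x : TorusSite 4 L), 0))⁻¹)
      (fun x => ρ (U ((Fin.cons t x : TorusSite 4 L), 0))) hρ)

end Summit.QuantumFields.QCD.Cruxes.StableActionBridge.Sketch

end
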